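import Mathlib
import Summits.ResolutionOfSingularities.ResolutionOfSingularities.Theorems.WeightedInvariantLocalWeightedDropNCResPhaseAssemblyPosB
import Summits.ResolutionOfSingularities.ResolutionOfSingularities.Theorems.WeightedInvariantLocalWeightedDropNCResRegimePresentedAssemblyPosB
import Summits.ResolutionOfSingularities.ResolutionOfSingularities.Theorems.WeightedInvariantLocalWeightedDropNCResRegimeLetterAssemblyPosB
import Summits.ResolutionOfSingularities.ResolutionOfSingularities.Theorems.WeightedInvariantLocalWeightedDropTOT2BridgePresentedExitPosB
import Summits.ResolutionOfSingularities.ResolutionOfSingularities.Theorems.WeightedInvariantLocalWeightedDropTOT2ConflictBudget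
import Summits.ResolutionOfSingularities.ResolutionOfSingularities.Theorems.WeightedInvariantLocalWeightedDropTOT2BridgePresByStep

/-!
# `WeightedInvariant.LocalWeightedDrop` ENGINE, W′|₄ line — D₃ᴮ CLOSED: res-L1-w43-strat-1's `stub_surfaceBoundaryNC₃` IS A THEOREM

Sub-problem `ResolutionOfSingularities`, ENGINE crux `stmt-ResolutionOfSingularities-8899` (`LocalWeightedDrop`), registered stub W′|₄
`stub_wildWideApexFourStartsWon`; res-L1-w43-strat-1's SNC₂ interface `g11/snc2_interface_v1.lean`, stub `stub_surfaceBoundaryNC₃` (the D₃ᴮ input of the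
x₀-lift `stub_pairLift`); res-L1-w43-plan-1 RULINGS 2026-08-27T21:45:42Z / 22:24:12Z / 22:28:19Z (D₃ᴮ lane, binders).  [OURS · L1 W4.3 · chain w43 ·
res-L1-w43-lead-1 g6; def-free; closes the D₃ᴮ chain …NCGameBWinsDefs → …NCResPhaseAssemblyB → …RegimesOfBudgetB / …BadDirB / …ApexColumnB →
…EndgameReductionB → …PhaseAssemblyPosB (the endgame dissolved into the order-one regimes) → …PresentedExitPosB / …PresByStepPosB (the one genuine `o ≥ 2`
use repaired; the twin budget context) → …RegimePresentedAssemblyPosB / …RegimeLetterAssemblyPosB; the budget is res-type-088's `stub_conflictBudget`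
(res-L1-w43-stub-2).  Nothing here is a statement of any manuscript; AI-produced, gate-checked, weaker than expert review.]

* `regimePresentedB_one`, `regimeLetterB_one` — regimes (P) (non-empty history) and (L) AT ORDER ONE in B-form, unconditional;
* **`surfaceBoundaryNC_B`** — over an algebraically closed field of prime characteristic, from EVERY admissibly decorated position of the three-letter NC game
  the mover B-forces (B-permissible moves, transform successors) a normal crossing;
* **`surfaceBoundaryNC₃`** — THE TEXT OF res-L1-w43-strat-1's `stub_surfaceBoundaryNC₃`, under its own binders, UNCONDITIONAL.
-/

set_option linter.dupNamespace false -- mandated namespace of this single-conjunct summit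

noncomputable section

namespace Summit.ResolutionOfSingularities.ResolutionOfSingularities.Theorems

namespace TameFourTupleDrop

open MvPowerSeries Literature.AlgebraicGeometry.Resolution PolyDescent

variable {k : Type} [Field k]

/-- An order drop is a head drop. -/
theorem Decoration.head_lt_of_o_lt (δ δ' : Decoration k 2) (h : δ'.o < δ.o) : δ'.head < δ.head := by
  rw [Decoration.head, Decoration.head, Prod.Lex.toLex_lt_toLex]; exact Or.inl h

/-- **REGIME (P) AT ORDER ONE WITH A NON-EMPTY HISTORY, B-form, UNCONDITIONAL** (three letters, `k` algebraically closed of characteristic `p`). -/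
theorem regimePresentedB_one (p : ℕ) [Fact p.Prime] [CharP k p] [IsAlgClosed k] :
    ∀ (b : MvPowerSeries (Fin (2 + 1)) k) (δ : Decoration k 2), Admissible b δ → δ.o = 1 → ¬ δ.HCol → δ.O.Nonempty →
      DBWinsTo (fun τ => Admissible τ.1 τ.2 ∧ (τ.2.head < δ.head ∨ (τ.2.head = δ.head ∧ τ.2.HCol))) (b, δ) := by
  intro b δ hadm ho hnc hO
  haveI : Infinite k := IsAlgClosed.instInfinite
  obtain ⟨M, hM_succ, hM_conf⟩ := stub_conflictBudget p Fact.out k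
  have h2 : 2 ≤ δ.c := by
    rw [Decoration.c, ho]
    have := Finset.card_pos.mpr hO
    omega
  refine regimePresentedB_of_pieces₁ (fun d => prepSelWP d) (fun d X hX => isPrepRecentring_prepSelWP_all d X hX) M hM_succ hM_conf
    (fun _ _ hadm ho hnot hO => Decoration.exists_presBy_of_presented₁ hadm ho hnot hO)
    (fun _ _ _ _ _ _ hadm ho h2 hcd hpres hWP hn => Decoration.hCol_of_presBy_of_not_inPoly₁ hadm ho h2 hcd hpres hWP hn)
    (fun b δ d A N Θ hadm ho hc hpres hin hconf => ?_) (fun b δ d A N Θ hadm ho hc hpres hin hconf => ?_) b δ hadm (by omega) h2 hnc hO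
  · obtain ⟨Φ, w, hmv, hcl⟩ := hpres.exists_bmove_of_not_conflict₁ hadm ho hc hin hconf
    refine ⟨Φ, w, hmv, hcl.mono fun τ' ⟨hadm', hcase⟩ => ⟨hadm', ?_⟩⟩
    exact hcase.imp (Decoration.head_lt_of_o_lt δ τ'.2) fun h => ⟨h.1, Or.inr h.2⟩
  · obtain ⟨Φ, w, hmv, hcl⟩ := hpres.exists_bmove_point₁ hadm ho hc hin
    refine ⟨Φ, w, hmv, hcl.mono fun τ' ⟨hadm', hcase⟩ => ⟨hadm', ?_⟩⟩
    exact hcase.imp (Decoration.head_lt_of_o_lt δ τ'.2) fun h => ⟨h.1, Or.inr h.2⟩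

/-- **REGIME (L) AT ORDER ONE, B-form, UNCONDITIONAL** (three letters, `k` algebraically closed of characteristic `p`). -/
theorem regimeLetterB_one (p : ℕ) [Fact p.Prime] [CharP k p] [IsAlgClosed k] :
    ∀ (b : MvPowerSeries (Fin (2 + 1)) k) (δ : Decoration k 2) (l : Fin (2 + 1)), Admissible b δ → δ.o = 1 → ¬ δ.HCol →
      δ.LetterDir l →
      DBWinsTo (fun τ => Admissible τ.1 τ.2 ∧ (τ.2.head < δ.head ∨ (τ.2.head = δ.head ∧ (τ.2.HCol ∨ τ.2.GoodDir ∨ τ.2.BadDir)))) (b, δ) := by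
  intro b δ l hadm ho _ hl
  haveI : Infinite k := IsAlgClosed.instInfinite
  obtain ⟨M, hM_succ, hM_conf⟩ := stub_conflictBudget p Fact.out k
  exact regimeLetterB_of_pieces₁ (fun d => prepSelWP d) (fun d X hX => isPrepRecentring_prepSelWP_all d X hX) M hM_succ hM_conf
    (fun _ _ hadm ho hnot hO => Decoration.exists_presBy_of_presented₁ hadm ho hnot hO)
    (fun _ _ _ _ _ _ hadm ho h2 hcd hpres hWP hn => Decoration.hCol_of_presBy_of_not_inPoly₁ hadm ho h2 hcd hpres hWP hn)
    (fun _ _ _ _ _ _ hadm ho hcd h hin hconf => h.exists_bmove_of_not_conflict₁ hadm ho hcd hin hconf)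
    (fun _ _ _ _ _ _ hadm ho hcd h hin _ => h.exists_bmove_point₁ hadm ho hcd hin) b δ hadm (by omega) hl

/-- **D₃ᴮ — POSITIONAL EMBEDDED NC-RESOLUTION OF SURFACE GERMS IN A REGULAR THREEFOLD GERM BY B-PERMISSIBLE MOVES WITH TRANSFORM SUCCESSORS, UNCONDITIONAL.**
Over an algebraically closed field of characteristic `p > 0`, from EVERY admissibly decorated position `(b, δ)` of the three-letter NC game the mover B-forces a
normal crossing. -/
theorem surfaceBoundaryNC_B (p : ℕ) [Fact p.Prime] [CharP k p] [IsAlgClosed k]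
    (b : MvPowerSeries (Fin (2 + 1)) k) (δ : Decoration k 2) (hadm : Admissible b δ) :
    DBWinsTo (fun τ : MvPowerSeries (Fin (2 + 1)) k × Decoration k 2 => GermIsNC τ.1) (b, δ) :=
  surfaceBoundaryNC_of_regimesPL₁ p (regimePresentedB_one p) (regimeLetterB_one p) b δ hadm

/-- **res-L1-w43-strat-1's `stub_surfaceBoundaryNC₃` (SNC₂ interface `g11/snc2_interface_v1.lean`), UNCONDITIONAL** — the D₃ᴮ input of the x₀-lift of the W′|₄
line, under the stub's own binders (the history hypothesis `δ.O = ∅` is idle). -/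
theorem surfaceBoundaryNC₃ : ∀ (p : ℕ), p.Prime → ∀ (k : Type) [Field k] [CharP k p] [IsAlgClosed k],
    ∀ (b : MvPowerSeries (Fin 3) k) (δ : Decoration k 2), Admissible b δ → δ.O = ∅ →
      DBWinsTo (fun τ : MvPowerSeries (Fin 3) k × Decoration k 2 => GermIsNC τ.1) (b, δ) := by
  intro p hp k _ _ _ b δ hadm _
  haveI : Fact p.Prime := ⟨hp⟩
  exact surfaceBoundaryNC_B p b δ hadm

end TameFourTupleDrop

end Summit.ResolutionOfSingularities.ResolutionOfSingularities.Theorems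

end
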